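/-
Copyright (c) 2026. All rights reserved.
Released under Apache 2.0 license as described in the file LICENSE.
Authors: abc-iut cell, campaign-S prover seat abc-iut-S8 (wave 2).
-/
import Mathlib.NumberTheory.Padics.Complex
import Mathlib.Analysis.Normed.Module.FiniteDimension
import Literature.RingTheory.Etale.PiTensorProductField
import Literature.IUT.LogVolume.TensorPacketRing
import HarnessLib

/-!
# The tensor packet `⊗_{ℚ_p} k_i` decomposes as a product of finite extensions of `ℚ_p` inside `ℚ̄_p`

[IUTchIV] Prop. 1.4 (i), kurims p. 13: "tensor products of finitely many finite extensions of `ℚ_p`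
over `ℤ_p` decompose, naturally, as direct sums of finitely many finite extensions of `ℚ_p`" — for
the `ℚ_p`-algebra `V = ⊗_{ℚ_p, i∈I} k_i` (`PacketAlgebra`, `TensorPacketRing.lean`, abc-iut-S1) of
finitely many fields `k_i` of the cell's norm-side MLF class.  This file PROVES the existence of a
decomposition datum of the kind `TensorPacketVolume.lean` takes as a parameter:

* `exists_packetDecomposition` — there are a finite index type `J`, finite subextensions
  `E_j ⊆ ℚ̄_p = PadicAlgCl p` of `ℚ_p`, and a `ℚ_p`-algebra isomorphism `V ≃ₐ[ℚ_p] ∏_j E_j`.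
  (Structure of finite étale algebras, `Literature.RingTheory.Etale.
  piTensorProduct_fields_exists_algEquiv_pi_field_of_charZero`, abc-iut-L6-t5; each abstract factor
  is then embedded into the algebraically closed `ℚ̄_p` by `IsAlgClosed.lift`.)  The factors
  `E_j ⊆ ℚ̄_p` are literally "finite extensions of `ℚ_p` contained in `ℚ̄_p`" as in Prop. 1.1, and carry
  the induced (spectral) norm, for which they are instances of the cell's setting
  (`PadicSubfields.lean`, abc-iut-S1).
Classical commutative algebra; nothing disputed.
-/

noncomputable section

namespace Literature.IUT.LogVolume

open Literature.RingTheory.Etale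

variable (p : ℕ) [Fact p.Prime]
variable {I : Type} [Fintype I]
variable (k : I → Type) [∀ i, NontriviallyNormedField (k i)] [∀ i, NormedAlgebra ℚ_[p] (k i)]
  [∀ i, ProperSpace (k i)]

omit [Fintype I] in
/-- Each `k_i` (locally compact) is a finite extension of `ℚ_p` (Riesz).
[cite: NeukirchANT1999, Ch. II Prop. (5.1)] -/
theorem finiteDimensional_factor (i : I) : FiniteDimensional ℚ_[p] (k i) :=
  FiniteDimensional.of_locallyCompactSpace ℚ_[p]

/-- A finite extension `F` of `ℚ_p` is `ℚ_p`-isomorphic to a finite subextension of `ℚ̄_p`.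
[cite: NeukirchANT1999, Ch. II §8] -/
theorem exists_intermediateField_algEquiv (F : Type) [Field F] [Algebra ℚ_[p] F]
    [FiniteDimensional ℚ_[p] F] :
    ∃ E : IntermediateField ℚ_[p] (PadicAlgCl p), FiniteDimensional ℚ_[p] E ∧ Nonempty (F ≃ₐ[ℚ_[p]] E) := by
  haveI : Algebra.IsAlgebraic ℚ_[p] F := Algebra.IsAlgebraic.of_finite ℚ_[p] F
  let f : F →ₐ[ℚ_[p]] PadicAlgCl p := IsAlgClosed.lift
  let e : F ≃ₐ[ℚ_[p]] f.fieldRange :=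
    (AlgEquiv.ofInjectiveField f).trans (Subalgebra.equivOfEq _ _ f.fieldRange_toSubalgebra.symm)
  exact ⟨f.fieldRange, LinearEquiv.finiteDimensional e.toLinearEquiv, ⟨e⟩⟩

/-- **`⊗_{ℚ_p} k_i ≃ ∏_j E_j` with `E_j ⊆ ℚ̄_p` finite over `ℚ_p`.**
[cite: Mochizuki2012, IUTchIV Prop. 1.4 (i) p. 13] -/
theorem exists_packetDecomposition :
    ∃ (J : Type) (_ : Fintype J) (E : J → IntermediateField ℚ_[p] (PadicAlgCl p)),
      (∀ j, FiniteDimensional ℚ_[p] (E j)) ∧ Nonempty (PacketAlgebra p k ≃ₐ[ℚ_[p]] (Π j, E j)) := by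
  haveI : ∀ i, FiniteDimensional ℚ_[p] (k i) := finiteDimensional_factor p k
  obtain ⟨J, hJ, F, hF, hA, hfin, ⟨ψ₀⟩⟩ :=
    piTensorProduct_fields_exists_algEquiv_pi_field_of_charZero ℚ_[p] k
  haveI : ∀ j, FiniteDimensional ℚ_[p] (F j) := fun j ↦ (hfin j).1
  choose E hEfin hE using fun j ↦ exists_intermediateField_algEquiv p (F j)
  let e : ∀ j, F j ≃ₐ[ℚ_[p]] E j := fun j ↦ (hE j).some
  exact ⟨J, hJ, E, hEfin, ⟨ψ₀.trans (AlgEquiv.piCongrRight e)⟩⟩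

end Literature.IUT.LogVolume

end
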